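import Summits.AtomisticToContinuum.FouriersLaw.Theorems.OddSectorIrreversibilityWitnessGluePairing

/-!
# `WitnessGlue` (stmt-AtomisticToContinuum-14072) — support 6: the leak through the two taps

Support file for `OddSectorIrreversibility.WitnessGlue`: in the main case (both tap derivatives
`∂_{p_0}u`, `∂_{p_{N-1}}u` in `L²(μ_T)`), the leak identity A(7) of `CorrectorTheory` (read through
the zero-friction dictionary), Cauchy–Schwarz in each tap, `‖∂_b u⁺‖ ≤ ‖∂_b u‖` and the `E3`
tangent bound give `leak_bound`: for a bond at distance `≥ q` from both contacts and `0 < t ≤ a q/2`,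
`⟨u⁻, j_i∘Φ_t⟩ ≥ ⟨u⁻, j_i⟩ - γ T √(2 Λ C Z) e^{-κ q/4} t`. No route statement is asserted.
-/

noncomputable section

namespace Summit.AtomisticToContinuum.FouriersLaw.Theorems.OddSectorWitness

open MeasureTheory Filter Topology ProbabilityTheory Set
open scoped NNReal ENNReal
open Literature.MathematicalPhysics.KineticTheory.HeatConduction
open Summit.AtomisticToContinuum.FouriersLaw.Theorems.ClosedConeSensitivity.Negative.ZeroFrictionDictionary

variable {ω₂ lam β : ℝ} (hω : 0 < ω₂) (hl : 0 ≤ lam) (hβ : 0 ≤ β)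
include hω hl hβ

/-! ## The leak of the pairing through the two taps -/

section Leak

variable (γ : ℝ) (N : ℕ) {T : ℝ}

omit hω hl hβ in
/-- Negation commutes with updating one coordinate. [folklore] -/
theorem neg_update (p : Fin N → ℝ) (b : Fin N) (r : ℝ) :
    -(Function.update p b r) = Function.update (-p) b (-r) := by
  funext i
  by_cases h : i = b
  · subst h; simp
  · simp [Function.update_of_ne h]

omit hω hl hβ in
/-- Momentum partial derivatives anticommute with the momentum reversal:
`∂_{p_b}(u∘Θ)(x) = -(∂_{p_b}u)(Θx)` (no differentiability needed: `deriv` of `r ↦ ψ(-r)`). [folklore] -/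
theorem partialP_comp_momentumReversal (u : PhaseSpace N → ℝ) (b : Fin N) (x : PhaseSpace N) :
    partialP b (fun y : PhaseSpace N => u (y.1, -y.2)) x = -partialP b u (x.1, -x.2) := by
  unfold partialP
  show deriv (fun t => u (x.1, -(Function.update x.2 b t))) (x.2 b) =
    -deriv (fun t => u (x.1, Function.update (-x.2) b t)) (-x.2 b)
  simp only [neg_update]
  exact deriv_comp_neg (f := fun s => u (x.1, Function.update (-x.2) b s)) (x.2 b)

omit hω hl hβ in
/-- For `u ∈ C¹`, the momentum partial derivative of the even part `u⁺ = (u + u∘Θ)/2` is the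
Θ-odd combination `(∂_{p_b}u - (∂_{p_b}u)∘Θ)/2`. [folklore] -/
theorem partialP_evenPart {u : PhaseSpace N → ℝ} (hu : ContDiff ℝ 1 u) (b : Fin N) (x : PhaseSpace N) :
    partialP b (fun y : PhaseSpace N => (u y + u (y.1, -y.2)) / 2) x =
      (partialP b u x - partialP b u (x.1, -x.2)) / 2 := by
  have hd : Differentiable ℝ u := hu.differentiable one_ne_zero
  have hΘ := partialP_comp_momentumReversal N u b x
  unfold partialP at hΘ ⊢
  have h1 : DifferentiableAt ℝ (fun r : ℝ => u (x.1, Function.update x.2 b r)) (x.2 b) := by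
    have hk : DifferentiableAt ℝ (fun r : ℝ => ((x.1, Function.update x.2 b r) : PhaseSpace N)) (x.2 b) :=
      (differentiableAt_const _).prodMk (hasDerivAt_update x.2 b _).differentiableAt
    exact (hd _).comp _ hk
  have h2 : DifferentiableAt ℝ (fun r : ℝ => u ((x.1, Function.update x.2 b r).1, -(x.1, Function.update x.2 b r).2))
      (x.2 b) := by
    have hk : DifferentiableAt ℝ
        (fun r : ℝ => (((x.1, Function.update x.2 b r).1, -(x.1, Function.update x.2 b r).2) : PhaseSpace N)) (x.2 b) :=
      (differentiableAt_const _).prodMk (hasDerivAt_update x.2 b _).differentiableAt.neg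
    exact (hd _).comp _ hk
  have hsum : (fun r : ℝ => (u (x.1, Function.update x.2 b r) +
      u ((x.1, Function.update x.2 b r).1, -(x.1, Function.update x.2 b r).2)) / 2) =
      fun r => (1 / 2 : ℝ) * (u (x.1, Function.update x.2 b r) +
        u ((x.1, Function.update x.2 b r).1, -(x.1, Function.update x.2 b r).2)) := by
    funext r; ring
  have h12 : DifferentiableAt ℝ (fun r : ℝ => u (x.1, Function.update x.2 b r) +
      u ((x.1, Function.update x.2 b r).1, -(x.1, Function.update x.2 b r).2)) (x.2 b) := h1.add h2
  beta_reduce at hΘ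
  rw [hsum, deriv_const_mul _ h12, deriv_fun_add h1 h2, hΘ]
  ring

/-- **The leak bound.** In the main case (`∂_{p_0}u, ∂_{p_{N-1}}u ∈ L²(μ_T)`), the leak identity of
`CorrectorTheory` (clause A(7), read through the zero-friction dictionary), Cauchy–Schwarz in each
tap, `‖∂_b u⁺‖ ≤ ‖∂_b u‖`, and the `E3` tangent bound give, for a bond at distance `≥ q` from both
contacts and times `0 < t ≤ a q / 2`:
`⟨u⁻, j_i∘Φ_t⟩ ≥ ⟨u⁻, j_i⟩ - γ T √(2 Λ C Z) e^{-κ q/4} t`, `Λ = ‖∂_{p_0}u‖² + ‖∂_{p_{N-1}}u‖²`. [folklore] -/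
theorem leak_bound (hT : 0 < T) (hγ : 0 ≤ γ) {a κ C : ℝ} (ha : 0 < a) (hκ : 0 < κ) (hC : 0 ≤ C)
    (hcone : ConeBoundAt ω₂ lam β γ T a κ C)
    {u : PhaseSpace N → ℝ} (hu : ContDiff ℝ 1 u)
    (b₀ b₁ : Fin N) (hb₀ : b₀.val = 0) (hb₁ : b₁.val = N - 1)
    (hQ₀ : MemLp (partialP b₀ u) 2 (gibbsWeight ω₂ lam β γ N T))
    (hQ₁ : MemLp (partialP b₁ u) 2 (gibbsWeight ω₂ lam β γ N T))
    (i : Fin N) {q : ℕ} (hqi : q ≤ i.val) (hqi' : q ≤ N - 2 - i.val)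
    (jt : ℝ → PhaseSpace N → ℝ)
    (hjt : ∀ s x, jt s x = (pinnedChain ω₂ lam β γ).bondCurrent N i (detFlow ω₂ lam β N ((s.toNNReal : ℝ≥0) : ℝ) x))
    (hA7 : ∀ t : ℝ, 0 ≤ t →
      (∫ x, (u x - u (x.1, -x.2)) / 2 * jt t x ∂(gibbsWeight ω₂ lam β γ N T)) -
        (∫ x, (u x - u (x.1, -x.2)) / 2 * (pinnedChain ω₂ lam β γ).bondCurrent N i x ∂(gibbsWeight ω₂ lam β γ N T)) =
      -(γ * T) * ∫ s in Ioc (0 : ℝ) t,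
        ((∫ x, partialP b₀ (fun y : PhaseSpace N => (u y + u (y.1, -y.2)) / 2) x * partialP b₀ (jt s) x
            ∂(gibbsWeight ω₂ lam β γ N T)) +
          ∫ x, partialP b₁ (fun y : PhaseSpace N => (u y + u (y.1, -y.2)) / 2) x * partialP b₁ (jt s) x
            ∂(gibbsWeight ω₂ lam β γ N T)))
    {t : ℝ} (ht : 0 < t) (htq : t ≤ a * q / 2) :
    ∫ x, (u x - u (x.1, -x.2)) / 2 * (pinnedChain ω₂ lam β γ).bondCurrent N i x ∂(gibbsWeight ω₂ lam β γ N T) -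
      γ * T * (Real.sqrt (2 * ((∫ x, (partialP b₀ u x) ^ 2 ∂(gibbsWeight ω₂ lam β γ N T)) +
        ∫ x, (partialP b₁ u x) ^ 2 ∂(gibbsWeight ω₂ lam β γ N T)) * C *
        ∫ x, Real.exp (-((pinnedChain ω₂ lam β γ).hamiltonian N x) / T) ∂volume) * Real.exp (-(κ * q / 4))) * t ≤
    ∫ x, (u x - u (x.1, -x.2)) / 2 * (pinnedChain ω₂ lam β γ).bondCurrent N i (detFlow ω₂ lam β N t x)
      ∂(gibbsWeight ω₂ lam β γ N T) := by
  set P := pinnedChain ω₂ lam β γ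
  set μ := gibbsWeight ω₂ lam β γ N T
  set Z : ℝ := ∫ x, Real.exp (-(P.hamiltonian N x) / T) ∂volume
  set Λ : ℝ := (∫ x, (partialP b₀ u x) ^ 2 ∂μ) + ∫ x, (partialP b₁ u x) ^ 2 ∂μ
  set ue : PhaseSpace N → ℝ := fun y => (u y + u (y.1, -y.2)) / 2 with hue
  have hΛ0 : 0 ≤ Λ := add_nonneg (integral_nonneg fun _ => sq_nonneg _) (integral_nonneg fun _ => sq_nonneg _)
  have hZ0 : 0 ≤ Z := integral_nonneg fun _ => (Real.exp_pos _).le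
  -- the even part's tap derivatives are in `L²` with norm at most that of `∂_b u`
  have hue_eq : ∀ b : Fin N, partialP b ue = fun x => (partialP b u x - partialP b u (x.1, -x.2)) / 2 :=
    fun b => funext fun x => partialP_evenPart N hu b x
  have hf2 : ∀ b : Fin N, MemLp (partialP b u) 2 μ → MemLp (partialP b ue) 2 μ ∧
      ∫ x, (partialP b ue x) ^ 2 ∂μ ≤ ∫ x, (partialP b u x) ^ 2 ∂μ := by
    intro b hb
    rw [hue_eq b]
    exact ⟨memLp_oddPart γ N hb, integral_sq_oddPart_le γ N hb⟩
  -- distances of the bond to the two contacts are at least `q`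
  have hdist : ∀ b : Fin N, (b.val = 0 ∨ b.val = N - 1) →
      (q : ℝ) ≤ ((if b.val = 0 then i.val else N - 2 - i.val : ℕ) : ℝ) := by
    intro b hb
    split_ifs
    · exact_mod_cast hqi
    · exact_mod_cast hqi'
  -- the tangent entry at time `s ∈ (0, t]` is small in `L²`
  have htan : ∀ b : Fin N, (b.val = 0 ∨ b.val = N - 1) → ∀ s ∈ Ioc (0 : ℝ) t,
      MemLp (partialP b (jt s)) 2 μ ∧
        ∫ x, (partialP b (jt s) x) ^ 2 ∂μ ≤ C * Real.exp (-(κ * q / 2)) * Z := by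
    intro b hb s hs
    have hs0 : 0 ≤ s := hs.1.le
    have hjts : jt s = fun y => P.bondCurrent N i (detFlow ω₂ lam β N s y) := by
      funext y; rw [hjt, Real.coe_toNNReal _ hs0]
    rw [hjts]
    have hsd : s ≤ a * ((if b.val = 0 then i.val else N - 2 - i.val : ℕ) : ℝ) := by
      have h1 : s ≤ a * q / 2 := hs.2.trans htq
      have h2 : a * q / 2 ≤ a * q := by nlinarith [ha.le, (Nat.cast_nonneg q : (0 : ℝ) ≤ q)]
      nlinarith [hdist b hb, ha.le]
    have hmem := memLp_partialP_transport hω hl hβ N hT hcone i b hb hs0 hsd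
    refine ⟨hmem, ?_⟩
    have hlin := lintegral_partialP_transport_sq_le hω hl hβ N hT hcone i b hb hs0 hsd
    have hint : Integrable (fun x => (partialP b (fun y => P.bondCurrent N i (detFlow ω₂ lam β N s y)) x) ^ 2) μ :=
      (memLp_two_iff_integrable_sq hmem.aestronglyMeasurable).1 hmem
    have heq := ofReal_integral_eq_lintegral_ofReal hint (Eventually.of_forall fun x => sq_nonneg _)
    have hexp : Real.exp (-(κ * (((if b.val = 0 then i.val else N - 2 - i.val : ℕ) : ℝ) - s / a))) ≤
        Real.exp (-(κ * q / 2)) := by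
      refine Real.exp_le_exp.2 ?_
      have h1 : s / a ≤ q / 2 := by
        rw [div_le_iff₀ ha]; nlinarith [hs.2, htq]
      nlinarith [hdist b hb, hκ.le]
    have hbound : C * Real.exp (-(κ * (((if b.val = 0 then i.val else N - 2 - i.val : ℕ) : ℝ) - s / a))) * Z ≤
        C * Real.exp (-(κ * q / 2)) * Z := by
      gcongr
    refine le_trans ?_ hbound
    have h := heq ▸ hlin
    exact (ENNReal.ofReal_le_ofReal_iff (by positivity)).1 h
  -- each tap's leak integrand at time `s`
  have hLb : ∀ b : Fin N, (b.val = 0 ∨ b.val = N - 1) → MemLp (partialP b u) 2 μ → ∀ s ∈ Ioc (0 : ℝ) t,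
      |∫ x, partialP b ue x * partialP b (jt s) x ∂μ| ≤
        Real.sqrt (∫ x, (partialP b u x) ^ 2 ∂μ) * Real.sqrt (C * Real.exp (-(κ * q / 2)) * Z) := by
    intro b hb hQ s hs
    obtain ⟨hf, hfle⟩ := hf2 b hQ
    obtain ⟨hg, hgle⟩ := htan b hb s hs
    refine (abs_integral_mul_le_sqrt hf hg).trans ?_
    exact mul_le_mul (Real.sqrt_le_sqrt hfle) (Real.sqrt_le_sqrt hgle) (Real.sqrt_nonneg _) (Real.sqrt_nonneg _)
  -- the sum of the two taps
  set M : ℝ := Real.sqrt (2 * Λ * C * Z) * Real.exp (-(κ * q / 4)) with hM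
  have hsum : ∀ s ∈ Ioc (0 : ℝ) t,
      ‖(∫ x, partialP b₀ ue x * partialP b₀ (jt s) x ∂μ) + ∫ x, partialP b₁ ue x * partialP b₁ (jt s) x ∂μ‖ ≤ M := by
    intro s hs
    have h0 := hLb b₀ (Or.inl hb₀) hQ₀ s hs
    have h1 := hLb b₁ (Or.inr hb₁) hQ₁ s hs
    rw [Real.norm_eq_abs]
    refine (abs_add_le _ _).trans ((add_le_add h0 h1).trans ?_)
    rw [← add_mul]
    set Q₀ := ∫ x, (partialP b₀ u x) ^ 2 ∂μ
    set Q₁ := ∫ x, (partialP b₁ u x) ^ 2 ∂μ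
    have hQ0' : 0 ≤ Q₀ := integral_nonneg fun _ => sq_nonneg _
    have hQ1' : 0 ≤ Q₁ := integral_nonneg fun _ => sq_nonneg _
    have h2Λ : 0 ≤ 2 * Λ := mul_nonneg zero_le_two hΛ0
    have hsq : Real.sqrt Q₀ + Real.sqrt Q₁ ≤ Real.sqrt (2 * Λ) := by
      have hnn : 0 ≤ Real.sqrt Q₀ + Real.sqrt Q₁ := add_nonneg (Real.sqrt_nonneg _) (Real.sqrt_nonneg _)
      rw [← Real.sqrt_sq hnn]
      refine Real.sqrt_le_sqrt ?_
      have hΛeq : Λ = Q₀ + Q₁ := rfl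
      nlinarith [sq_nonneg (Real.sqrt Q₀ - Real.sqrt Q₁), Real.sq_sqrt hQ0', Real.sq_sqrt hQ1',
        Real.sqrt_nonneg Q₀, Real.sqrt_nonneg Q₁]
    have hexp : Real.sqrt (C * Real.exp (-(κ * q / 2)) * Z) = Real.sqrt (C * Z) * Real.exp (-(κ * q / 4)) := by
      have he : Real.exp (-(κ * q / 2)) = (Real.exp (-(κ * q / 4))) ^ 2 := by
        rw [← Real.exp_nat_mul]; congr 1; ring
      rw [show C * Real.exp (-(κ * q / 2)) * Z = (C * Z) * Real.exp (-(κ * q / 2)) by ring, Real.sqrt_mul (by positivity),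
        he, Real.sqrt_sq (Real.exp_pos _).le]
    rw [hexp]
    calc (Real.sqrt Q₀ + Real.sqrt Q₁) * (Real.sqrt (C * Z) * Real.exp (-(κ * q / 4)))
        ≤ Real.sqrt (2 * Λ) * (Real.sqrt (C * Z) * Real.exp (-(κ * q / 4))) :=
          mul_le_mul_of_nonneg_right hsq (by positivity)
      _ = M := by
          rw [hM, show 2 * Λ * C * Z = (2 * Λ) * (C * Z) by ring, Real.sqrt_mul h2Λ]
          ring
  -- the time integral of the leak
  have hI : ‖∫ s in Ioc (0 : ℝ) t, ((∫ x, partialP b₀ ue x * partialP b₀ (jt s) x ∂μ) +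
      ∫ x, partialP b₁ ue x * partialP b₁ (jt s) x ∂μ)‖ ≤ M * t := by
    have h := norm_setIntegral_le_of_norm_le_const (μ := (volume : Measure ℝ)) (s := Ioc (0 : ℝ) t)
      (by rw [Real.volume_Ioc]; exact ENNReal.ofReal_lt_top) hsum
    rwa [Measure.real, Real.volume_Ioc, sub_zero, ENNReal.toReal_ofReal ht.le] at h
  -- conclude from the leak identity
  have hA := hA7 t ht.le
  have hjtt : ∀ x, jt t x = P.bondCurrent N i (detFlow ω₂ lam β N t x) := fun x => by
    rw [hjt, Real.coe_toNNReal _ ht.le]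
  simp only [hjtt] at hA
  rw [Real.norm_eq_abs] at hI
  have hγT : 0 ≤ γ * T := mul_nonneg hγ hT.le
  have habs := abs_le.1 hI
  nlinarith [habs.1, habs.2, hγT]

end Leak

end Summit.AtomisticToContinuum.FouriersLaw.Theorems.OddSectorWitness
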